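import Literature.AlgebraicGeometry.AbelianSchemes.AbelianSchemeDualPair
import Literature.AlgebraicGeometry.Modules.DetClassTensor
import Literature.AlgebraicGeometry.Modules.DetClassDual
import Literature.AlgebraicGeometry.Modules.PullbackFrame
import Literature.AlgebraicGeometry.Modules.CechPicOfLocalRing
import Literature.AlgebraicGeometry.Modules.UnitCocyclePresented
import Literature.AlgebraicGeometry.Modules.UnitCocyclePullback
import HarnessLib

/-!
# Rigidifying a rank-one module along the unit section: `L ↦ L ⊗ (π^*ε^*L)⁻¹` is trivial along `ε` and has the SAME CLASS ON EVERY FIBRE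
# ([MumfordFogartyKirwan1994] Ch. 6 §1 (rigidification, p. 117); [MumfordAV1970] §13 (p. 123))

Layer `Literature/AlgebraicGeometry/AbelianSchemes`, namespace `Literature.AlgebraicGeometry.AbelianSchemes.AbelianSchemeOver`.  THEOREMS ONLY (no definition,
no named fact, no instance, no notation, no `sorry`).  Cell `hodgecm-mathlib` (D-0151), P6 «MOD programme», L4 DUALS road, organ **(O4-η)** of the stage
Mumford-bundle package (LA4-p05 (g0)): the binder `hε : CechPic.pullback A.unitSection (detClass …) = 1` of the letter `DualPairOfAmpleRigidified` for the stage
spread `Lₛ` of ★ O4-β `LocalizationRelativeRankOneSpread`, WITHOUT descending the generic rigidification: replace `Lₛ` by its normalisation `Lₛ ⊗ (π^*ε^*Lₛ)⁻¹`,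
whose class on every fibre over a field-valued (hence local) point is that of `Lₛ` — so the `hΘ` witnesses of ★ O4-γ `RankOneAmpleClassSpreadStage` and the
`hwit` of ★ O4-ε `RankOneLocalEmbeddingSpreadDedekind` are unchanged (in class form).  HC_CM is proved only modulo the printed citations until rung 0 closes;
this file is generic abelian-scheme bookkeeping and changes no count.

For an abelian scheme `π : A → S` with unit section `ε` and a rank-one `L` on `A`:
* **`exists_rankOne_rigidified_sameFibreClass`** — there is a rank-one `L′` (namely `L ⊗ (π^*ε^*L)^∨`, ★ `hasRank_tensorObj_one`, ★ `hasRank_dual`) with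
  `ε^*[L′] = 1` in `Ȟ¹(S, 𝒪^×)` (`ε ≫ π = 𝟙`, ★ `detClass_tensorObj_of_hasRank_one`, ★ `detClass_dual`, ★ `detClass_pullback`) and, at EVERY field-valued point
  `s : Spec Ω → S`, `(A_s → A)^*[L′] = (A_s → A)^*[L]` (the correction `π^*ε^*[L]` restricts on `A_s` to `pr₂^* s^* ε^*[L]` and `Ȟ¹(Spec Ω, 𝒪^×) = 1`, ★
  `CechPic.pullback_eq_one_of_isLocalRing`).

## References
* [MumfordFogartyKirwan1994] D. Mumford, J. Fogarty, F. Kirwan, *Geometric Invariant Theory*, 3rd ed. (1994), Ch. 6 §1 (rigidified line bundles, p. 117), §2 Def. 6.2.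
* [MumfordAV1970] D. Mumford, *Abelian Varieties* (1970), §13 (p. 123) (`L` rigidified along the identity).
* [Hartshorne1977] R. Hartshorne, *Algebraic Geometry* (1977), II Ex. 6.8, II Ex. 6.11, III Ex. 4.5 (`Pic = Ȟ¹(𝒪^×)`).
-/

set_option autoImplicit false

noncomputable section

-- `TopCat.Presheaf`/`Scheme.Modules` bookkeeping (as in ★ `DetClassTensor`).
set_option backward.isDefEq.respectTransparency false

universe u

open CategoryTheory CategoryTheory.Limits AlgebraicGeometry MonoidalCategory

namespace Literature.AlgebraicGeometry.Modules

/-- `(𝟙 X)^* = id` on `Ȟ¹(X, 𝒪_X^×)` (the pulled-back cocycle has the same opens and transition functions; ★ `UnitCocycle.equiv_of_eq`). [folklore] -/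
private theorem CechPic.pullback_id' {X : Scheme.{u}} (a : CechPic X) : CechPic.pullback (𝟙 X) a = a := by
  obtain ⟨c, rfl⟩ := CechPic.mk_surjective a
  rw [CechPic.pullback_mk]
  refine CechPic.sound (UnitCocycle.equiv_of_eq (UnitCocycle.pullback (𝟙 X) c) c c.U c.mem (fun _ => le_rfl) (fun _ => le_rfl) ?_)
  intro x y V hx hy
  change c.g x y V _ _ = (𝟙 X : X ⟶ X).appLE (c.U x ⊓ c.U y) V _ (c.g x y _ inf_le_left inf_le_right)
  rw [Scheme.Hom.appLE, Scheme.Hom.id_app, Category.id_comp]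
  exact (c.map_g x y inf_le_left inf_le_right _).symm

end Literature.AlgebraicGeometry.Modules

namespace Literature.AlgebraicGeometry.AbelianSchemes

namespace AbelianSchemeOver

open Literature.AlgebraicGeometry.Motives Literature.AlgebraicGeometry.Modules

/-- **RIGIDIFICATION ALONG THE UNIT SECTION KEEPS THE FIBRE CLASSES** ([MumfordFogartyKirwan1994] Ch. 6 §1): for a rank-one `L` on an abelian scheme
`π : A → S`, the rank-one `L′ := L ⊗ (π^*ε^*L)^∨` satisfies `ε^*[L′] = 1` in `Ȟ¹(S, 𝒪^×)` and `(A_s → A)^*[L′] = (A_s → A)^*[L]` in `Ȟ¹(A_s, 𝒪^×)` at every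
field-valued point `s : Spec Ω → S` (`Ȟ¹(Spec Ω, 𝒪^×)` is trivial).  Hence every hypothesis «class of an ample divisor at the geometric points» holds for `L′`
iff it holds for `L`, and `L′` carries the rigidification binder `hε` of the letters `exists_kOfL_etale_of_isUnit` ∕ `DualPairOfAmpleRigidified`.
[cite: MumfordFogartyKirwan1994, Ch. 6 §1 (p. 117) and §2 Definition 6.2 (p. 120)] [cite: MumfordAV1970, §13 (p. 123)] [cite: Hartshorne1977, II Ex. 6.8 and III Ex. 4.5] -/
theorem exists_rankOne_rigidified_sameFibreClass {S : Scheme.{u}} (A : AbelianSchemeOver S) (L : A.left.Modules) (hL : HasRank L 1) :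
    ∃ (L' : A.left.Modules) (hL' : HasRank L' 1),
      CechPic.pullback A.unitSection (detClass (HasRank.isFiniteLocallyFree' hL')) = 1 ∧
      ∀ ⦃Ω : Type u⦄ [Field Ω] (s : Spec (.of Ω) ⟶ S),
        CechPic.pullback (pullback.fst A.X.hom s) (detClass (HasRank.isFiniteLocallyFree' hL')) =
          CechPic.pullback (pullback.fst A.X.hom s) (detClass (HasRank.isFiniteLocallyFree' hL)) := by
  -- the correction `N := (π^*ε^*L)^∨`, rank one, of class `(π^*ε^*[L])⁻¹`
  let E : A.left.Modules := (Scheme.Modules.pullback A.X.hom).obj ((Scheme.Modules.pullback A.unitSection).obj L)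
  have hE : HasRank E 1 := hasRank_pullback _ (hasRank_pullback _ hL)
  let N : A.left.Modules := Modules.dual E
  have hN : HasRank N 1 := hasRank_dual hE
  let L' : A.left.Modules := tensorObj L N
  have hL' : HasRank L' 1 := hasRank_tensorObj_one hL hN
  -- classes
  have hEcl : detClass (HasRank.isFiniteLocallyFree' hE) =
      CechPic.pullback A.X.hom (CechPic.pullback A.unitSection (detClass (HasRank.isFiniteLocallyFree' hL))) := by
    have h1 : detClass (HasRank.isFiniteLocallyFree' hE) =
        detClass (((HasRank.isFiniteLocallyFree' hL).pullback A.unitSection).pullback A.X.hom) := rfl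
    rw [h1, detClass_pullback A.X.hom ((HasRank.isFiniteLocallyFree' hL).pullback A.unitSection),
      detClass_pullback A.unitSection (HasRank.isFiniteLocallyFree' hL)]
  have hNcl : detClass (HasRank.isFiniteLocallyFree' hN) = (detClass (HasRank.isFiniteLocallyFree' hE))⁻¹ := by
    rw [← detClass_dual (HasRank.isFiniteLocallyFree' hE)]
  have hL'cl : detClass (HasRank.isFiniteLocallyFree' hL') =
      detClass (HasRank.isFiniteLocallyFree' hL) * (CechPic.pullback A.X.hom (CechPic.pullback A.unitSection (detClass (HasRank.isFiniteLocallyFree' hL))))⁻¹ := by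
    have h := detClass_tensorObj_of_hasRank_one' hL hN
    rw [hNcl, hEcl] at h
    exact h
  refine ⟨L', hL', ?_, fun Ω _ s => ?_⟩
  · -- `ε^*[L′] = ε^*[L] · ((ε ≫ π)^* ε^*[L])⁻¹ = 1`
    rw [hL'cl, map_mul, map_inv, ← CechPic.pullback_comp, A.unitSection_comp_hom]
    rw [Modules.CechPic.pullback_id']
    exact mul_inv_cancel _
  · -- on the fibre over `s`: the correction is pulled back from `Spec Ω`, where `Ȟ¹(𝒪^×)` is trivial
    rw [hL'cl, map_mul, map_inv, ← CechPic.pullback_comp, pullback.condition, CechPic.pullback_comp,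
      CechPic.pullback_eq_one_of_isLocalRing s, map_one, inv_one, mul_one]

end AbelianSchemeOver

end Literature.AlgebraicGeometry.AbelianSchemes

end
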